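import Summits.QuantumFields.YangMills.Theorems.VirialFluxGapResolventFieldCutoff
import Mathlib.Analysis.SpecialFunctions.SmoothTransition
import Mathlib.Analysis.Calculus.Deriv.Slope
import HarnessLib

/-!
# Route `VirialFluxGap` (YangMills): the RESOLVENT EULER FIELD — the smooth DEFICIT STEP `ψ` (`= 1` on `[0,½]`, `= 0` on `[1,∞)`, `ψ′ ≤ 0`)
# and the signed cut-off term for `χ = ψ(F₀/t₀)`

Toward the deciding crux `VirialFluxGap.PeriodicSoftness` (item stmt-QuantumFields-24141), resolvent Euler field (memo
`fcl-p3-g40-RESOLVENT-EULER-FIELD-24141-v3.md` §3(a)).  The field is cut off at deficit level `t₀` by `ψ(F₀/t₀)`; ✓`deficitCutoff_term_nonpos`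
shows the resulting divergence term has the good sign whenever `ψ′ ≤ 0`.  This file fixes ONE concrete `ψ` from Mathlib's `Real.smoothTransition`:

* §1 def `deficitStep r = smoothTransition (2 − 2r)`; `contDiff_deficitStep`, `deficitStep_eq_one` (`r ≤ ½`), `deficitStep_eq_zero` (`1 ≤ r`),
  `deficitStep_nonneg`, `deficitStep_le_one`, `deficitStep_antitone`, `deriv_deficitStep_nonpos`;
* §2 ★ `deficitStep_cutoff_term_nonpos`: ✓`deficitCutoff_term_nonpos` instantiated — for every frame family, `t₀ > 0`, floor `c > 0`:
  `Σ_j ∂_{τ_j}[ψ(F₀/t₀)]·½(A⁻¹g)_j ≤ 0`.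

HONEST LABEL: plumbing; the Euler field is NOT assembled; ⟨24141⟩, ⟨22884⟩ remain OPEN; the Yang–Mills mass gap is NOT proved; no summit is
proved by a line.  DEFINITION `deficitStep` + theorems (0 `sorry`), standard axioms.  Explicit-unit seat `ym-line-fcl-p3` g40 (cell ym-idea-1,
free hands), `--supports stmt-QuantumFields-24141`.  References: [folklore].
-/

set_option autoImplicit false

noncomputable section

open scoped Matrix BigOperators ContDiff Topology
open MeasureTheory Set Matrix
open Literature.MathematicalPhysics.QuantumFieldTheory hiding SU2
open Literature.MathematicalPhysics.QuantumLattice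
open Literature.MathematicalPhysics.QuantumFieldTheory.SUNBakryEmery (expSU coe_expSU matTop)

namespace Summit.QuantumFields.YangMills.Theorems.VirialFluxGap.FrameHessian

open Summit.QuantumFields.YangMills.Theorems.FemtoTransferGap
open Summit.QuantumFields.YangMills.Theorems.FemtoTransferGap.TT
open Summit.QuantumFields.YangMills.Theorems.VirialFluxGap.RingDeficit
open Summit.QuantumFields.YangMills.Theorems.VirialFluxGap.FrameDerivative
open Summit.QuantumFields.YangMills.Theorems.VirialFluxGap.ResolventField

/-! ## §1 The smooth step -/

/-- The smooth DEFICIT STEP: `ψ(r) = smoothTransition(2 − 2r)` — equal to `1` for `r ≤ ½`, to `0` for `r ≥ 1`, smooth and non-increasing.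
[folklore] -/
def deficitStep (r : ℝ) : ℝ := Real.smoothTransition (2 - 2 * r)

/-- The step is smooth. [folklore] -/
theorem contDiff_deficitStep : ContDiff ℝ ∞ deficitStep :=
  Real.smoothTransition.contDiff.comp (contDiff_const.sub (contDiff_const.mul contDiff_id))

/-- `ψ = 1` on `(-∞, ½]`. [folklore] -/
theorem deficitStep_eq_one {r : ℝ} (hr : r ≤ 1 / 2) : deficitStep r = 1 :=
  Real.smoothTransition.one_of_one_le (by linarith)

/-- `ψ = 0` on `[1, ∞)`. [folklore] -/
theorem deficitStep_eq_zero {r : ℝ} (hr : 1 ≤ r) : deficitStep r = 0 :=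
  Real.smoothTransition.zero_of_nonpos (by linarith)

/-- `0 ≤ ψ`. [folklore] -/
theorem deficitStep_nonneg (r : ℝ) : 0 ≤ deficitStep r := Real.smoothTransition.nonneg _

/-- `ψ ≤ 1`. [folklore] -/
theorem deficitStep_le_one (r : ℝ) : deficitStep r ≤ 1 := Real.smoothTransition.le_one _

/-- `ψ` is non-increasing. [folklore] -/
theorem deficitStep_antitone : Antitone deficitStep := fun a b hab =>
  Real.smoothTransition.monotone (by linarith)

/-- `ψ′ ≤ 0` everywhere. [folklore] -/
theorem deriv_deficitStep_nonpos (r : ℝ) : deriv deficitStep r ≤ 0 := deficitStep_antitone.deriv_nonpos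

/-! ## §2 The signed cut-off term -/

variable {L : ℕ} [NeZero L]
variable {ι : Type*} [Fintype ι] [DecidableEq ι]

/-- ★ **The deficit cut-off term of the resolvent field has the good sign** for `χ = ψ(F₀/t₀)` with the smooth step `ψ = deficitStep`:
`Σ_j ∂_{τ_j}[ψ(ringPoly/t₀)]·½(A⁻¹g)_j ≤ 0` whenever `t₀ > 0` and `A = H + λ⋆1` has a positive floor. [folklore] -/
theorem deficitStep_cutoff_term_nonpos {t₀ : ℝ} (ht₀ : 0 < t₀) (τ : ι → ((Fin (2 * L - 1 + 1) × Edge 3 L) ⊕ Site 3 L) → Matrix (Fin 2) (Fin 2) ℂ) (lam : ℝ) (M : ((Fin (2 * L - 1 + 1) → Edge 3 L → Matrix (Fin 2) (Fin 2) ℂ) × (Site 3 L → Matrix (Fin 2) (Fin 2) ℂ))) {c : ℝ} (hc : 0 < c)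
    (hfl : ∀ v, c * (v ⬝ᵥ v) ≤ v ⬝ᵥ ((frameHess (L := L) τ M + lam • (1 : Matrix ι ι ℝ)) *ᵥ v)) :
    ∑ j, frameD (τ j) (fun M' => deficitStep (ringPoly L M' / t₀)) M *
        ((1 / 2) * (((frameHess (L := L) τ M + lam • (1 : Matrix ι ι ℝ))⁻¹ *ᵥ frameGrad (L := L) τ M) j)) ≤ 0 :=
  deficitCutoff_term_nonpos contDiff_deficitStep ht₀ τ lam M (deriv_deficitStep_nonpos _) hc hfl

end Summit.QuantumFields.YangMills.Theorems.VirialFluxGap.FrameHessian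

end
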